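import Summits.ValiantsHypothesis.ValiantsHypothesis.Theorems.KPlusLogSqLawTropicalCycleMonotone

/-!
# Route «KPlusLogSqLaw», crux `TropicalB` (stmt-ValiantsHypothesis-19771) — FRESH EXCHANGES: no labeled exchange recurs,
and chains of bounded-change steps are polynomial

HONEST FRAMING.  Helper file of the object-search cell `pub-symmetroid` (seat val-sym-trop-p5 g2, refuter-adjacent lane) for the
crux `Summit.ValiantsHypothesis.ValiantsHypothesis.Theses.KPlusLogSqLaw.TropicalB` (ledger item `stmt-ValiantsHypothesis-19771`,
route `KPlusLogSqLaw`, registered stubs `stub_tropThin` / `stub_tropFat` of `Cruxes/TropicalB/Lines/birth.lean`), landed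
`--supports`; it does NOT close the item and asserts nothing about `TropicalB` in its window, `Lifting`, `KPlusLogSqLaw`,
`MatrixDescartes` (stmt-ValiantsHypothesis-18050) or `VP ≠ VNP`.  Everything below is a STRUCTURAL fact about chains of unique
optima (`IsDominant`) at strictly increasing integer slopes of an ARBITRARY dominance design of an arbitrary format `(m, K)`: no
support class, no exponent regime, no sign condition.

THE FACT (no labeled exchange recurs, `exchange_fresh`).  Call a LABELED EXCHANGE a column set `J` together with an «old» and a
«new» (row, class) datum for every column of `J`, the old rows and the new rows of `J` being the same SET of rows, and old ≠ new
somewhere on `J`.  A step `k → k+1` of a dominant chain PERFORMS the exchange if the term at `k` carries the old data on `J` and the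
term at `k+1` the new data (off `J` anything may happen).  Then at most ONE step of the chain performs a given labeled exchange.
Proof: by the cell's cyclewise monotonicity (`sum_d_lt_of_isDominant_invariant`, conjb-2 g4 / val-sym-trop-p4, imported) an
invariant block on which two chain terms differ carries strictly MORE exponent mass at the later term; a step performing the
exchange raises the mass of `J` from `Σ_J d(old)` to `Σ_J d(new)`, and if a later step performed it again, the pair (term after the
first performance, term before the second) would have to raise it from `Σ_J d(new)` back to `Σ_J d(old)`.  Every step is a labeled
exchange on any column set containing its moved columns (`image_eq_of_moved_subset`), so in particular NO STEP OF A DOMINANT CHAIN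
EVER REPEATS, not even embedded in different ambient terms: thresholds are fixed numbers and an exchange fires once.  (The special
case `J = {b}` with a common row — a pure class switch at one entry fires once — is the tree's `d_lt_of_isDominant_of_sameEntry` /
`permStep_noRepeat` / `switch_window` (lift-p3, lift-p2, lift-p1) behind the landed class-switch budget `n ≤ P + m²(K−1)`
(`…TropicalPermutationChanges.le_permChanges_add`, `…TropicalBSwitchBudget.chain_le_permChanges_add`); those are not restated.)

THE COUNT (`chain_le_pow_of_changes`, `chain_le_pow_of_card_changes`).  If every step of a dominant chain with pairwise distinct
consecutive terms changes the (row, class) of at most `ℓ` columns, then `n ≤ (m·(mK)²)^ℓ`: the map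
`step ↦ (its ≤ ℓ changed columns with their old and new data)` is injective by `exchange_fresh`.  So chains of BOUNDED-CHANGE steps
are POLYNOMIAL in `m` and `K`, uniformly — for every fixed `ℓ` far inside the budget `2^{C(K + ⌊log₂m⌋²)}` of `TropicalB`, with no
hypothesis on the exponents (compare the cell's lex-regime short-step law `n ≤ m(ℓ+1)^K`, `…TropicalBShortSteps`, linear in `m` but
exponential in `K`) and none on the support (compare the two-sided-band law `…TropicalBBandedPolynomial`).  Refuter calibration
(what a counterexample to `TropicalB` must look like, complementing `refuter-calibration-TropicalB.md` on the item): along a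
super-polynomial chain family the steps changing `≤ ℓ` columns are polynomially many for every fixed `ℓ`, so almost every step changes
an unbounded number of columns, and the design must contain super-polynomially many DISTINCT labeled exchanges firing in the chain's
order.  [folklore: exchange/threshold arguments for parametric assignment; this packaging is the cell's]
-/

set_option linter.dupNamespace false
set_option autoImplicit false

namespace Summit.ValiantsHypothesis.ValiantsHypothesis.Theorems.KPlusLogSqLaw

open Summit.ValiantsHypothesis.ValiantsHypothesis.Theorems.MatrixDescartes.Negative
open scoped BigOperators
open Finset

/-! ## 1. Invariant column blocks -/

/-- **Image form ⇒ quotient form.**  If the permutations `σ₁`, `σ₂` map the column set `T` onto the same set of rows, then `T` is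
invariant under the quotient `σ₁⁻¹σ₂` (the hypothesis shape of `sum_d_lt_of_isDominant_invariant`). [folklore] -/
theorem invariant_of_image_eq {m : ℕ} (σ₁ σ₂ : Equiv.Perm (Fin m)) (T : Finset (Fin m))
    (h : T.image σ₁ = T.image σ₂) : ∀ b, (σ₁⁻¹ * σ₂) b ∈ T ↔ b ∈ T := by
  classical
  intro b
  have hc : σ₁ ((σ₁⁻¹ * σ₂) b) = σ₂ b := by simp
  constructor
  · intro hcT
    have hmem : σ₁ ((σ₁⁻¹ * σ₂) b) ∈ T.image σ₂ := h ▸ mem_image_of_mem _ hcT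
    obtain ⟨b', hb', hb'eq⟩ := mem_image.mp hmem
    rw [hc] at hb'eq
    exact (σ₂.injective hb'eq) ▸ hb'
  · intro hbT
    have hmem : σ₂ b ∈ T.image σ₁ := h ▸ mem_image_of_mem _ hbT
    obtain ⟨c', hc', hc'eq⟩ := mem_image.mp hmem
    rw [← hc] at hc'eq
    exact (σ₁.injective hc'eq) ▸ hc'

/-- **Moved columns generate invariant blocks.**  If `T` contains every column on which the permutations `σ₁`, `σ₂` differ, then
`σ₁` and `σ₂` map `T` onto the same set of rows: every step of a chain is a labeled exchange on any such `T`. [folklore] -/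
theorem image_eq_of_moved_subset {m : ℕ} (σ₁ σ₂ : Equiv.Perm (Fin m)) (T : Finset (Fin m))
    (hT : ∀ b, σ₁ b ≠ σ₂ b → b ∈ T) : T.image σ₁ = T.image σ₂ := by
  classical
  symm
  apply Finset.eq_of_subset_of_card_le
  · intro i hi
    obtain ⟨b, hb, rfl⟩ := mem_image.mp hi
    refine mem_image.mpr ⟨σ₁.symm (σ₂ b), ?_, by simp⟩
    by_cases hfix : σ₁.symm (σ₂ b) = b
    · rw [hfix]; exact hb
    · apply hT
      intro heq
      rw [Equiv.apply_symm_apply] at heq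
      exact hfix (σ₂.injective heq).symm
  · rw [Finset.card_image_of_injective _ σ₁.injective, Finset.card_image_of_injective _ σ₂.injective]

/-- Two distinct terms differ in some column (in row or in class). [folklore] -/
theorem exists_col_ne {m K : ℕ} (P Q : Equiv.Perm (Fin m) × (Fin m → Fin K)) (h : P ≠ Q) :
    ∃ b, (P.1 b, P.2 b) ≠ (Q.1 b, Q.2 b) := by
  by_contra hcon
  push Not at hcon
  apply h
  refine Prod.ext (Equiv.ext fun b => ?_) (funext fun b => ?_)
  · exact congrArg Prod.fst (hcon b)
  · exact congrArg Prod.snd (hcon b)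

/-! ## 2. No labeled exchange recurs -/

/-- **Fresh exchanges.**  Along a chain of unique optima at strictly increasing integer slopes, a labeled exchange — a column
set `J`, old data `old j = (row, class)` and new data `new j` for `j ∈ J`, with the old and new rows of `J` the same set of rows and
`old ≠ new` somewhere on `J` — is performed by at most one step: if the steps `k → k+1` and `k' → k'+1` both carry `old` on `J`
before and `new` on `J` after, then `k = k'`. [folklore; via `sum_d_lt_of_isDominant_invariant`] -/
theorem exchange_fresh {m K : ℕ} (d : Fin K → ℕ) (v ε : Fin m → Fin m → Fin K → ℤ) {n : ℕ} (θ : Fin (n + 1) → ℤ)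
    (p : Fin (n + 1) → Equiv.Perm (Fin m) × (Fin m → Fin K)) (hθ : StrictMono θ)
    (hdom : ∀ k, IsDominant d v ε (θ k) (p k)) (J : Finset (Fin m)) (old new : Fin m → Fin m × Fin K)
    (hinv : J.image (fun j => (old j).1) = J.image (fun j => (new j).1)) (hne : ∃ j ∈ J, old j ≠ new j)
    {k k' : Fin n}
    (hk : ∀ j ∈ J, ((p k.castSucc).1 j, (p k.castSucc).2 j) = old j ∧ ((p k.succ).1 j, (p k.succ).2 j) = new j)
    (hk' : ∀ j ∈ J, ((p k'.castSucc).1 j, (p k'.castSucc).2 j) = old j ∧ ((p k'.succ).1 j, (p k'.succ).2 j) = new j) :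
    k = k' := by
  classical
  -- exponent masses of the two data on `J`
  set A : ℤ := ∑ j ∈ J, (d (old j).2 : ℤ) with hA
  set B : ℤ := ∑ j ∈ J, (d (new j).2 : ℤ) with hB
  -- generic step: if index `a < b` in `Fin (n+1)` carry `new` resp. `old` on `J`, then `B < A`; if `old` resp. `new`, then `A < B`
  have mono : ∀ (a b : Fin (n + 1)), a < b → ∀ (da db : Fin m → Fin m × Fin K),
      J.image (fun j => (da j).1) = J.image (fun j => (db j).1) → (∃ j ∈ J, da j ≠ db j) →
      (∀ j ∈ J, ((p a).1 j, (p a).2 j) = da j) → (∀ j ∈ J, ((p b).1 j, (p b).2 j) = db j) →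
      ∑ j ∈ J, (d (da j).2 : ℤ) < ∑ j ∈ J, (d (db j).2 : ℤ) := by
    intro a b hab da db hinv' hne' ha hb
    have hTa : J.image (p a).1 = J.image (fun j => (da j).1) :=
      Finset.image_congr fun j hj => congrArg Prod.fst (ha j (Finset.mem_coe.mp hj))
    have hTb : J.image (p b).1 = J.image (fun j => (db j).1) :=
      Finset.image_congr fun j hj => congrArg Prod.fst (hb j (Finset.mem_coe.mp hj))
    have hT : J.image (p a).1 = J.image (p b).1 := by rw [hTa, hTb, hinv']
    have hdiff : ∃ j ∈ J, (p a).1 j ≠ (p b).1 j ∨ (p a).2 j ≠ (p b).2 j := by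
      obtain ⟨j, hj, hj'⟩ := hne'
      refine ⟨j, hj, ?_⟩
      by_contra hcon
      push Not at hcon
      apply hj'
      rw [← ha j hj, ← hb j hj, hcon.1, hcon.2]
    have h1 : IsDominant d v ε (θ a) ((p a).1, (p a).2) := by rw [Prod.mk.eta]; exact hdom a
    have h2 : IsDominant d v ε (θ b) ((p b).1, (p b).2) := by rw [Prod.mk.eta]; exact hdom b
    have key := sum_d_lt_of_isDominant_invariant d v ε (hθ hab) h1 h2 J (invariant_of_image_eq _ _ J hT) hdiff
    have ea : ∑ j ∈ J, (d ((p a).2 j) : ℤ) = ∑ j ∈ J, (d (da j).2 : ℤ) :=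
      Finset.sum_congr rfl fun j hj => by rw [← ha j hj]
    have eb : ∑ j ∈ J, (d ((p b).2 j) : ℤ) = ∑ j ∈ J, (d (db j).2 : ℤ) :=
      Finset.sum_congr rfl fun j hj => by rw [← hb j hj]
    rw [ea, eb] at key
    exact key
  have hne' : ∃ j ∈ J, new j ≠ old j := by
    obtain ⟨j, hj, h⟩ := hne; exact ⟨j, hj, fun e => h e.symm⟩
  -- the comparison of two performing steps
  have main : ∀ k k' : Fin n, k < k' →
      (∀ j ∈ J, ((p k.castSucc).1 j, (p k.castSucc).2 j) = old j ∧ ((p k.succ).1 j, (p k.succ).2 j) = new j) →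
      (∀ j ∈ J, ((p k'.castSucc).1 j, (p k'.castSucc).2 j) = old j ∧ ((p k'.succ).1 j, (p k'.succ).2 j) = new j) →
      False := by
    intro k k' hkk' hk hk'
    -- the first performance raises the mass of `J` from `A` to `B`
    have up : A < B := mono k.castSucc k.succ (Fin.castSucc_lt_succ) old new hinv hne
      (fun j hj => (hk j hj).1) (fun j hj => (hk j hj).2)
    have hle : (k.succ : Fin (n + 1)) ≤ k'.castSucc := by
      rw [Fin.le_iff_val_le_val, Fin.val_succ, Fin.val_castSucc]
      exact hkk'
    rcases hle.eq_or_lt with heq | hlt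
    · -- the same term carries `new` and `old` on `J`
      obtain ⟨j, hj, hj'⟩ := hne
      apply hj'
      rw [← (hk' j hj).1, ← heq, (hk j hj).2]
    · -- a later performance would have to lower it back from `B` to `A`
      have down : B < A := mono k.succ k'.castSucc hlt new old hinv.symm hne'
        (fun j hj => (hk j hj).2) (fun j hj => (hk' j hj).1)
      exact lt_asymm up down
  rcases lt_trichotomy k k' with hlt | heq | hgt
  · exact (main k k' hlt hk hk').elim
  · exact heq
  · exact (main k' k hgt hk' hk).elim

/-! ## 3. Chains of bounded-change steps are polynomial -/

/-- **Bounded-change chains are polynomial (enumerated form).**  Let `p 0, …, p n` be unique optima at strictly increasing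
integer slopes with consecutive terms distinct, and suppose for every step `k` the columns whose (row, class) changes are among
`e k 0, …, e k (ℓ−1)`.  Then `n ≤ (m·(mK)·(mK))^ℓ`: by `exchange_fresh` the map sending a step to its list of (column, old datum,
new datum) is injective. [folklore] -/
theorem chain_le_pow_of_changes {m K : ℕ} (d : Fin K → ℕ) (v ε : Fin m → Fin m → Fin K → ℤ) {n ℓ : ℕ}
    (θ : Fin (n + 1) → ℤ) (p : Fin (n + 1) → Equiv.Perm (Fin m) × (Fin m → Fin K)) (hθ : StrictMono θ)
    (hdom : ∀ k, IsDominant d v ε (θ k) (p k)) (hne : ∀ k : Fin n, p k.castSucc ≠ p k.succ)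
    (e : Fin n → Fin ℓ → Fin m)
    (he : ∀ (k : Fin n) (j : Fin m), ((p k.castSucc).1 j, (p k.castSucc).2 j) ≠ ((p k.succ).1 j, (p k.succ).2 j) →
      ∃ i, e k i = j) :
    n ≤ (m * ((m * K) * (m * K))) ^ ℓ := by
  classical
  let Φ : Fin n → (Fin ℓ → Fin m × ((Fin m × Fin K) × (Fin m × Fin K))) := fun k i =>
    (e k i, (((p k.castSucc).1 (e k i), (p k.castSucc).2 (e k i)), ((p k.succ).1 (e k i), (p k.succ).2 (e k i))))
  have hΦ : Function.Injective Φ := by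
    intro k k' hkk'
    have hpt : ∀ i, e k i = e k' i ∧
        ((p k.castSucc).1 (e k i), (p k.castSucc).2 (e k i)) = ((p k'.castSucc).1 (e k' i), (p k'.castSucc).2 (e k' i)) ∧
        ((p k.succ).1 (e k i), (p k.succ).2 (e k i)) = ((p k'.succ).1 (e k' i), (p k'.succ).2 (e k' i)) := by
      intro i
      have h := congrFun hkk' i
      simp only [Φ, Prod.mk.injEq] at h
      exact ⟨h.1, Prod.ext h.2.1.1 h.2.1.2, Prod.ext h.2.2.1 h.2.2.2⟩
    -- the witness block of step `k`
    set J : Finset (Fin m) := univ.image (e k) with hJ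
    have hmemJ : ∀ j, ((p k.castSucc).1 j, (p k.castSucc).2 j) ≠ ((p k.succ).1 j, (p k.succ).2 j) → j ∈ J := by
      intro j hj
      obtain ⟨i, hi⟩ := he k j hj
      exact mem_image.mpr ⟨i, mem_univ _, hi⟩
    refine exchange_fresh d v ε θ p hθ hdom J (fun j => ((p k.castSucc).1 j, (p k.castSucc).2 j))
      (fun j => ((p k.succ).1 j, (p k.succ).2 j)) ?_ ?_ (fun j _ => ⟨rfl, rfl⟩) ?_
    · -- the old and the new rows of `J` are the same set
      exact image_eq_of_moved_subset (p k.castSucc).1 (p k.succ).1 J fun j hj => hmemJ j fun h => hj (congrArg Prod.fst h)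
    · obtain ⟨j, hj⟩ := exists_col_ne _ _ (hne k)
      exact ⟨j, hmemJ j hj, hj⟩
    · intro j hj
      obtain ⟨i, -, rfl⟩ := mem_image.mp hj
      obtain ⟨hei, hold, hnew⟩ := hpt i
      rw [hei] at hold hnew ⊢
      exact ⟨hold.symm, hnew.symm⟩
  have hcard := Fintype.card_le_of_injective Φ hΦ
  simpa [Fintype.card_fun, Fintype.card_prod, Fintype.card_fin] using hcard

/-- **Bounded-change chains are polynomial.**  If along a chain of unique optima at strictly increasing integer slopes with
consecutive terms distinct every step changes the (row, class) of at most `ℓ` columns, then `n ≤ (m·(mK)·(mK))^ℓ` — polynomial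
in `m` and `K` for every fixed `ℓ`, with no hypothesis on the exponents or on the support. [folklore] -/
theorem chain_le_pow_of_card_changes {m K : ℕ} (d : Fin K → ℕ) (v ε : Fin m → Fin m → Fin K → ℤ) {n : ℕ} (ℓ : ℕ)
    (θ : Fin (n + 1) → ℤ) (p : Fin (n + 1) → Equiv.Perm (Fin m) × (Fin m → Fin K)) (hθ : StrictMono θ)
    (hdom : ∀ k, IsDominant d v ε (θ k) (p k)) (hne : ∀ k : Fin n, p k.castSucc ≠ p k.succ)
    (hℓ : ∀ k : Fin n, ∃ J : Finset (Fin m), J.card ≤ ℓ ∧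
      ∀ j, ((p k.castSucc).1 j, (p k.castSucc).2 j) ≠ ((p k.succ).1 j, (p k.succ).2 j) → j ∈ J) :
    n ≤ (m * ((m * K) * (m * K))) ^ ℓ := by
  classical
  choose Jf hJc hJm using hℓ
  -- a base point in every witness block
  have hj0 : ∀ k : Fin n, ∃ j, j ∈ Jf k := by
    intro k
    obtain ⟨j, hj⟩ := exists_col_ne _ _ (hne k)
    exact ⟨j, hJm k j hj⟩
  choose j0 hj0 using hj0
  -- enumerate the witness block, padded with the base point
  let e : Fin n → Fin ℓ → Fin m := fun k i =>
    if h : (i : ℕ) < (Jf k).card then (Jf k).orderEmbOfFin rfl ⟨i, h⟩ else j0 k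
  refine chain_le_pow_of_changes d v ε θ p hθ hdom hne e fun k j hj => ?_
  have hjJ : j ∈ Jf k := hJm k j hj
  -- the position of `j` in the increasing enumeration of `Jf k`
  obtain ⟨i', hi'⟩ : ∃ i' : Fin (Jf k).card, (Jf k).orderEmbOfFin rfl i' = j := by
    have : j ∈ Set.range ((Jf k).orderEmbOfFin rfl) := by
      rw [Finset.range_orderEmbOfFin]; exact Finset.mem_coe.mpr hjJ
    exact this
  refine ⟨⟨i', lt_of_lt_of_le i'.isLt (hJc k)⟩, ?_⟩
  simp only [e, dif_pos i'.isLt]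
  exact hi'

/-! ## 4. The bounded-change steps of an ARBITRARY chain are polynomially many -/

/-- **Bounded-change steps are polynomially many (enumerated form).**  Along ANY chain of unique optima at strictly increasing
integer slopes with consecutive terms distinct, let `S` be a set of steps each of which changes the (row, class) only at columns among
`e k 0, …, e k (ℓ−1)`.  Then `#S ≤ (m·(mK)·(mK))^ℓ` — no hypothesis on the other steps.  (`chain_le_pow_of_changes` is the case
`S = all steps`.) [folklore] -/
theorem card_steps_le_pow_of_changes {m K : ℕ} (d : Fin K → ℕ) (v ε : Fin m → Fin m → Fin K → ℤ) {n ℓ : ℕ}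
    (θ : Fin (n + 1) → ℤ) (p : Fin (n + 1) → Equiv.Perm (Fin m) × (Fin m → Fin K)) (hθ : StrictMono θ)
    (hdom : ∀ k, IsDominant d v ε (θ k) (p k)) (hne : ∀ k : Fin n, p k.castSucc ≠ p k.succ)
    (S : Finset (Fin n)) (e : Fin n → Fin ℓ → Fin m)
    (he : ∀ k ∈ S, ∀ j : Fin m, ((p k.castSucc).1 j, (p k.castSucc).2 j) ≠ ((p k.succ).1 j, (p k.succ).2 j) →
      ∃ i, e k i = j) :
    S.card ≤ (m * ((m * K) * (m * K))) ^ ℓ := by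
  classical
  let Φ : S → (Fin ℓ → Fin m × ((Fin m × Fin K) × (Fin m × Fin K))) := fun k i =>
    (e k.1 i, (((p k.1.castSucc).1 (e k.1 i), (p k.1.castSucc).2 (e k.1 i)),
      ((p k.1.succ).1 (e k.1 i), (p k.1.succ).2 (e k.1 i))))
  have hΦ : Function.Injective Φ := by
    rintro ⟨k, hkS⟩ ⟨k', hk'S⟩ hkk'
    have hpt : ∀ i, e k i = e k' i ∧
        ((p k.castSucc).1 (e k i), (p k.castSucc).2 (e k i)) = ((p k'.castSucc).1 (e k' i), (p k'.castSucc).2 (e k' i)) ∧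
        ((p k.succ).1 (e k i), (p k.succ).2 (e k i)) = ((p k'.succ).1 (e k' i), (p k'.succ).2 (e k' i)) := by
      intro i
      have h := congrFun hkk' i
      simp only [Φ, Prod.mk.injEq] at h
      exact ⟨h.1, Prod.ext h.2.1.1 h.2.1.2, Prod.ext h.2.2.1 h.2.2.2⟩
    set J : Finset (Fin m) := univ.image (e k) with hJ
    have hmemJ : ∀ j, ((p k.castSucc).1 j, (p k.castSucc).2 j) ≠ ((p k.succ).1 j, (p k.succ).2 j) → j ∈ J := by
      intro j hj
      obtain ⟨i, hi⟩ := he k hkS j hj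
      exact mem_image.mpr ⟨i, mem_univ _, hi⟩
    apply Subtype.ext
    refine exchange_fresh d v ε θ p hθ hdom J (fun j => ((p k.castSucc).1 j, (p k.castSucc).2 j))
      (fun j => ((p k.succ).1 j, (p k.succ).2 j)) ?_ ?_ (fun j _ => ⟨rfl, rfl⟩) ?_
    · exact image_eq_of_moved_subset (p k.castSucc).1 (p k.succ).1 J fun j hj => hmemJ j fun h => hj (congrArg Prod.fst h)
    · obtain ⟨j, hj⟩ := exists_col_ne _ _ (hne k)
      exact ⟨j, hmemJ j hj, hj⟩
    · intro j hj
      obtain ⟨i, -, rfl⟩ := mem_image.mp hj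
      obtain ⟨hei, hold, hnew⟩ := hpt i
      rw [hei] at hold hnew ⊢
      exact ⟨hold.symm, hnew.symm⟩
  have hcard := Fintype.card_le_of_injective Φ hΦ
  simpa [Fintype.card_fun, Fintype.card_prod, Fintype.card_fin, Fintype.card_coe] using hcard

/-- **Bounded-change steps are polynomially many.**  Along ANY chain of unique optima at strictly increasing integer slopes with
consecutive terms distinct, the steps that change the (row, class) of at most `ℓ` columns number at most `(m·(mK)·(mK))^ℓ` — so
along a super-polynomial chain family almost every step changes an unbounded number of columns.  No hypothesis on exponents, support
or signs. [folklore] -/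
theorem card_steps_le_pow_of_card_changes {m K : ℕ} (d : Fin K → ℕ) (v ε : Fin m → Fin m → Fin K → ℤ) {n : ℕ} (ℓ : ℕ)
    (θ : Fin (n + 1) → ℤ) (p : Fin (n + 1) → Equiv.Perm (Fin m) × (Fin m → Fin K)) (hθ : StrictMono θ)
    (hdom : ∀ k, IsDominant d v ε (θ k) (p k)) (hne : ∀ k : Fin n, p k.castSucc ≠ p k.succ) (S : Finset (Fin n))
    (hℓ : ∀ k ∈ S, ∃ J : Finset (Fin m), J.card ≤ ℓ ∧
      ∀ j, ((p k.castSucc).1 j, (p k.castSucc).2 j) ≠ ((p k.succ).1 j, (p k.succ).2 j) → j ∈ J) :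
    S.card ≤ (m * ((m * K) * (m * K))) ^ ℓ := by
  classical
  -- a witness block for every step (the full column set off `S`; only steps of `S` are enumerated)
  have hJ : ∀ k : Fin n, ∃ J : Finset (Fin m), (k ∈ S → J.card ≤ ℓ) ∧
      ∀ j, ((p k.castSucc).1 j, (p k.castSucc).2 j) ≠ ((p k.succ).1 j, (p k.succ).2 j) → j ∈ J := by
    intro k
    by_cases hk : k ∈ S
    · obtain ⟨J, hJc, hJm⟩ := hℓ k hk
      exact ⟨J, fun _ => hJc, hJm⟩
    · exact ⟨univ, fun h => absurd h hk, fun j _ => mem_univ j⟩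
  choose Jf hJc hJm using hJ
  have hj0 : ∀ k : Fin n, ∃ j, j ∈ Jf k := by
    intro k
    obtain ⟨j, hj⟩ := exists_col_ne _ _ (hne k)
    exact ⟨j, hJm k j hj⟩
  choose j0 hj0 using hj0
  let e : Fin n → Fin ℓ → Fin m := fun k i =>
    if h : (i : ℕ) < (Jf k).card then (Jf k).orderEmbOfFin rfl ⟨i, h⟩ else j0 k
  refine card_steps_le_pow_of_changes d v ε θ p hθ hdom hne S e fun k hk j hj => ?_
  have hjJ : j ∈ Jf k := hJm k j hj
  obtain ⟨i', hi'⟩ : ∃ i' : Fin (Jf k).card, (Jf k).orderEmbOfFin rfl i' = j := by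
    have : j ∈ Set.range ((Jf k).orderEmbOfFin rfl) := by
      rw [Finset.range_orderEmbOfFin]; exact Finset.mem_coe.mpr hjJ
    exact this
  refine ⟨⟨i', lt_of_lt_of_le i'.isLt (hJc k hk)⟩, ?_⟩
  simp only [e, dif_pos i'.isLt]
  exact hi'

/-! ## 5. Regime-free long-step law: the chain length is at most (number of long steps) + a polynomial -/

/-- **Long-step law (regime-free, additive).**  Along ANY chain of unique optima at strictly increasing integer slopes with consecutive
terms distinct, if `T` contains every step that changes the (row, class) of MORE than `ℓ` columns («long steps»), then
`n ≤ #T + (m·(mK)·(mK))^ℓ`: all but polynomially many steps are long.  Compare the cell's lex-regime law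
`n ≤ m·(J+1)·(ℓ+1)^K` (`…TropicalBLongCarries`, multiplicative in the number `J` of long steps, linear in `m`); here the long steps
enter ADDITIVELY and there is no hypothesis on exponents, support or signs. [folklore] -/
theorem chain_le_longSteps_add_pow {m K : ℕ} (d : Fin K → ℕ) (v ε : Fin m → Fin m → Fin K → ℤ) {n : ℕ} (ℓ : ℕ)
    (θ : Fin (n + 1) → ℤ) (p : Fin (n + 1) → Equiv.Perm (Fin m) × (Fin m → Fin K)) (hθ : StrictMono θ)
    (hdom : ∀ k, IsDominant d v ε (θ k) (p k)) (hne : ∀ k : Fin n, p k.castSucc ≠ p k.succ) (T : Finset (Fin n))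
    (hT : ∀ k : Fin n, k ∉ T → ∃ J : Finset (Fin m), J.card ≤ ℓ ∧
      ∀ j, ((p k.castSucc).1 j, (p k.castSucc).2 j) ≠ ((p k.succ).1 j, (p k.succ).2 j) → j ∈ J) :
    n ≤ T.card + (m * ((m * K) * (m * K))) ^ ℓ := by
  classical
  have hS := card_steps_le_pow_of_card_changes d v ε ℓ θ p hθ hdom hne (univ \ T)
    (fun k hk => hT k (Finset.mem_sdiff.mp hk).2)
  have hsum : (univ \ T).card + T.card = n := by
    rw [Finset.card_sdiff_add_card_eq_card (Finset.subset_univ T), Finset.card_univ, Fintype.card_fin]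
  omega

end Summit.ValiantsHypothesis.ValiantsHypothesis.Theorems.KPlusLogSqLaw
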